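import Literature.Analysis.FluidPDE.NSAnalyticityRadiusLinfty
import Literature.Analysis.FluidPDE.OseenSchemePicard
import Literature.Analysis.FluidPDE.NSBoundedMildSmoothing
import Literature.Analysis.UnboundedOperators.HeatKernelGaussianData
import HarnessLib

/-!
# Guberović 2010 holds: the analyticity radius `√(νt)/c₀` of the bounded mild solution

Analysis/FluidPDE proofs file (everything proved; no definitions, no named facts): the discharge
`guberovic2010_analyticity_radius_holds` of the named fact
`Literature.Analysis.FluidPDE.guberovic2010_analyticity_radius` (`NSAnalyticityRadiusLinfty.lean`;
R. Guberović, DCDS 27 (2010) 231–236 = the case `p = ∞` of Grujić–Kukavica 1998, as restated in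
Bradshaw–Grujić–Kukavica 2016, Thm. 2.4.1 and Grujić 2013, Thm. 3.1: for `u₀ ∈ L^∞(ℝ³)`
(divergence-free) the mild solution on `(0, 1/(c₀²‖u₀‖_∞²))` extends holomorphically in space to
the tube `{x + iy : |y| < c₀⁻¹√t}` with the bound `c₀‖u₀‖_∞`).

## The proof given here (and how it differs from the printed one)

The printed proofs (Grujić–Kukavica 1998, Guberović 2010) complexify the Picard iterates of the
mild formulation IN SPACE and estimate them in `L^∞` on the growing strips `|y| ≤ c√s`. The tree
already contains most of another complexification of the same iteration — Lemarié-Rieusset's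
proof of his Thm. 9.12 (2016), vendored as the layers `OseenKernelComplex*.lean`,
`OseenSchemeComplex*.lean` (complex ROOT TIME `m`, `m² = νt`, and a complex GALILEAN PARAMETER `g`
in place of the complex space variable; `|g| < (νT₀)^{-1/2}`), completed here by
`OseenSchemeComplexDuhamel.lean` (the bilinear term preserves the class of scheme fields) and
`OseenSchemePicard.lean` (the iteration converges to a field `U(m, g)(x)` holomorphic in `(m, g)`,
bounded by `2K_G M`, Galilean covariant, real on the real axis, whose real restriction `u` solves
Oseen's integral equation `u = e^{νtΔ}b - B^ν_0(u,u)`). The spatial tube is then read off from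
**holomorphy in the Galilean parameter plus Galilean covariance**
`U(m, g)(x + e) = U(m, g - m⁻²e)(x)`: at the real root time `m = √(νt)` the map
`x + iy ↦ U(m, -m⁻²(iy))(x)` is holomorphic on the tube `|y| < νt/√(νT₀)` (locally it is
`ζ ↦ U(m, -m⁻²(ζ - x₀))(x₀)`), restricts to `u(t)` on `ℝ³`, and is bounded by `2K_G M`. Since the
iterates do not depend on `T₀`, one may take `T₀ = 2t` for each `t` in the window, which gives the
radius `√(νt)/√2 ≥ c₀⁻¹√(νt)`. The window `ν/(c₀²M²)`, the bound `c₀M` and the radius are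
obtained with `c₀ = 8√2 C_B K_G + 2K_G + 2` (`K_G = freeConstC`, `C_B = duhamelConstC`). The datum
`a ∈ L^∞` is replaced by its bounded representative `(M/max(M,‖a‖)) a` (same caloric extension,
`heatExtension_congr_ae'`), and the initial time `s` is restored by time translation
(`oseenDuhamel_translate`). The divergence-free hypothesis of the fact is not needed for the
construction (Oseen's integral equation is solved for every bounded datum), exactly as in the
printed theorem, where it only enters the interpretation of the mild solution as a solution of NSE.
So this is the printed theorem with a different (but classical, Lemarié-Rieusset 2016 pp. 260–263)
complexification; the statement proved is literally the vendored one.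

## Mathlib / tree search

Tree: `picardLimitC`, `picardLimitReal`, `isSchemeField_picardLimitC`, `picardLimitReal_eq`,
`isGalileanCovariantOn_picardLimitC`, `complexify_picardLimitReal`,
`continuousOn_uncurry_picardLimitReal`, `freeConstC`, `duhamelConstC` (`OseenSchemePicard.lean`);
`schemeDomain`, `sqrt_mem_schemeDomain`, `ofReal_sqrt_sq`; `complexTube` and its API
(`NSAnalyticityRadiusLinfty.lean`); `oseenDuhamel_translate` (`NSBoundedMildSmoothing.lean`);
`UnboundedOperators.heatExtension_congr_ae'`; `ae_norm_le_of_eLpNorm_top_le`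
(`OseenMildUniqueness.lean`). Mathlib: `ContinuousOn.aestronglyMeasurable`,
`DifferentiableOn.comp`, `DifferentiableOn.congr`, `IsOpen.mem_nhds`, `EuclideanSpace.norm_eq`.

## References

* R. Guberović, *Smoothness of Koch–Tataru solutions to the Navier–Stokes equations revisited*,
  Discrete Contin. Dyn. Syst. 27 (2010) 231–236, doi:10.3934/dcds.2010.27.231 (main theorem;
  not held — statement from the two restatements below). [Guberovic2010]
* Z. Bradshaw, Z. Grujić, I. Kukavica, LMS Lecture Notes 430, CUP 2016, Thm. 2.4.1 (PDF p. 31).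
  [BradshawGrujicKukavica2016]
* Z. Grujić, Nonlinearity 26 (2013) 289–296 = arXiv:1111.0217, Thm. 3.1, Remark 3.1 (p. 6).
  [Grujic2012]
* P. G. Lemarié-Rieusset, *The Navier–Stokes Problem in the 21st Century*, CRC Press 2016,
  Thm. 9.12, proof pp. 260–263 (the complexified Oseen scheme used here). [LemarieRieusset2016]
-/

noncomputable section

open MeasureTheory Set Function Filter Metric
open _root_.Topology
open scoped ENNReal NNReal

namespace Literature.Analysis.FluidPDE

open Literature.Analysis.FunctionSpaces.EuclideanSpace (complexify complexify_apply norm_complexify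
  complexify_injective continuous_complexify)
open UnboundedOperators (heatExtension)

/-! ### Real and imaginary coordinates in `ℂ^ι` -/

section ReIm

variable {ι : Type*} [Fintype ι]

/-- Every `ζ ∈ ℂ^ι` is `cx (Re ζ) + I • cx (Im ζ)` coordinatewise. [folklore] -/
theorem complexify_toLp_re_add_I_smul_toLp_im (ζ : EuclideanSpace ℂ ι) :
    complexify (WithLp.toLp 2 fun i => (ζ i).re : EuclideanSpace ℝ ι) +
        Complex.I • complexify (WithLp.toLp 2 fun i => (ζ i).im : EuclideanSpace ℝ ι) = ζ := by
  ext i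
  rw [complexify_add_I_smul_complexify_apply]
  simp [mul_comm Complex.I, Complex.re_add_im]

/-- The real coordinates of `cx x + I • cx y` are `x`. [folklore] -/
theorem re_toLp_complexify_add_I_smul (x y : EuclideanSpace ℝ ι) :
    (WithLp.toLp 2 fun i => ((complexify x + Complex.I • complexify y) i).re : EuclideanSpace ℝ ι) = x := by
  ext i
  simp

/-- The imaginary coordinates of `cx x + I • cx y` are `y`. [folklore] -/
theorem im_toLp_complexify_add_I_smul (x y : EuclideanSpace ℝ ι) :
    (WithLp.toLp 2 fun i => ((complexify x + Complex.I • complexify y) i).im : EuclideanSpace ℝ ι) = y := by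
  ext i
  simp

/-- The imaginary coordinates do not see a real translation. [folklore] -/
theorem im_toLp_sub_complexify (ζ : EuclideanSpace ℂ ι) (x : EuclideanSpace ℝ ι) :
    (WithLp.toLp 2 fun i => ((ζ - complexify x) i).im : EuclideanSpace ℝ ι) =
      WithLp.toLp 2 fun i => (ζ i).im := by
  ext i
  simp [complexify_apply]

/-- The Euclidean norm of the imaginary coordinates is at most the norm: `‖Im ζ‖ ≤ ‖ζ‖`.
[folklore] -/
theorem norm_im_toLp_le (ζ : EuclideanSpace ℂ ι) :
    ‖(WithLp.toLp 2 fun i => (ζ i).im : EuclideanSpace ℝ ι)‖ ≤ ‖ζ‖ := by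
  rw [EuclideanSpace.norm_eq, EuclideanSpace.norm_eq]
  refine Real.sqrt_le_sqrt (Finset.sum_le_sum fun i _ => ?_)
  have h : |(ζ i).im| ≤ ‖ζ i‖ := Complex.abs_im_le_norm _
  have h' : ‖(WithLp.toLp 2 (fun i => (ζ i).im) : EuclideanSpace ℝ ι) i‖ = |(ζ i).im| := by
    simp [Real.norm_eq_abs]
  rw [h']
  exact pow_le_pow_left₀ (abs_nonneg _) h 2

/-- `‖I • cx y‖ = ‖y‖`. [folklore] -/
theorem norm_I_smul_complexify (y : EuclideanSpace ℝ ι) : ‖Complex.I • complexify y‖ = ‖y‖ := by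
  rw [norm_smul, Complex.norm_I, one_mul, norm_complexify]

/-- `cx x + I • cx y - cx x₀ = cx (x - x₀) + I • cx y`. [folklore] -/
theorem complexify_add_I_smul_sub_complexify (x y x₀ : EuclideanSpace ℝ ι) :
    complexify x + Complex.I • complexify y - complexify x₀ = complexify (x - x₀) + Complex.I • complexify y := by
  rw [map_sub]
  abel

end ReIm

/-! ### Galilean parameters at a real root time -/

section Domain

variable {ι : Type*} [Fintype ι]

/-- **Admissible complex Galilean parameters at the real root time `√(ντ)`**: for
`0 < τ < T₀` and `w ∈ ℂ^ι` with `‖w‖ < ντ/√(νT₀)`, the pair `(√(ντ), -(ντ)⁻¹ w)` lies in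
`schemeDomain ν T₀`. [folklore] -/
theorem sqrt_neg_inv_smul_mem_schemeDomain {ν T₀ τ : ℝ} (hν : 0 < ν) (hτ : 0 < τ) (hτT : τ < T₀)
    {w : EuclideanSpace ℂ ι} (hw : ‖w‖ < ν * τ / Real.sqrt (ν * T₀)) :
    (((((Real.sqrt (ν * τ) : ℝ) : ℂ)),
        -((((Real.sqrt (ν * τ) : ℝ) : ℂ)) ^ 2)⁻¹ • w) : ℂ × EuclideanSpace ℂ ι) ∈ schemeDomain ν T₀ := by
  have h0 := sqrt_mem_schemeDomain (ι := ι) hν hτ hτT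
  have hντ : 0 < ν * τ := mul_pos hν hτ
  have hνT : 0 < ν * T₀ := mul_pos hν (hτ.trans hτT)
  have hs : 0 < Real.sqrt (ν * T₀) := Real.sqrt_pos.2 hνT
  refine ⟨h0.1, h0.2.1, h0.2.2.1, ?_⟩
  simp only
  rw [norm_smul, norm_neg, norm_inv, ofReal_sqrt_sq hντ.le, Complex.norm_real,
    Real.norm_of_nonneg hντ.le]
  rw [lt_div_iff₀ hs] at hw
  rw [inv_mul_lt_iff₀ hντ, ← div_eq_mul_inv, lt_div_iff₀ hs]
  linarith

/-! ### The spatial tube from holomorphy in the Galilean parameter -/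

/-- **The tube extension of a covariant scheme field at a real root time.** Let `U` be a scheme
field on `schemeDomain ν T₀` with bound `K`, Galilean covariant there, and real on the axis at the
root time `m = √(ντ)`, `0 < τ < T₀`: `U(m, 0) z = cx (f z)`. Then for every
`r ≤ ντ/√(νT₀)` the slice `f` is the restriction to `ℝ^ι` of the map
`x + iy ↦ U(m, -m⁻²(iy))(x)`, which is complex differentiable on the open tube
`complexTube ι r = {|Im| < r}` and bounded there by `K`. Locally, near `x₀ + iy₀`, this map is
`ζ ↦ U(m, -m⁻²(ζ - x₀))(x₀)` by covariance (`U(m,g)(x₀ + e) = U(m, g - m⁻²e)(x₀)`), a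
holomorphic function of `ζ` on the ball `‖ζ - x₀‖ < ντ/√(νT₀)` (admissible parameters,
`sqrt_neg_inv_smul_mem_schemeDomain`; `|Im ζ| ≤ ‖ζ - x₀‖`). This is how the Galilean
complexification of Lemarié-Rieusset's scheme yields the spatial strip of Grujić–Kukavica /
Guberović. [folklore] -/
theorem exists_tube_extension_of_covariant {ν T₀ τ K : ℝ} (hν : 0 < ν) (hτ : 0 < τ) (hτT : τ < T₀)
    {U : ℂ × EuclideanSpace ℂ ι → EuclideanSpace ℝ ι → EuclideanSpace ℂ ι}
    (hU : IsSchemeField ν T₀ K U) (hcov : IsGalileanCovariantOn (schemeDomain ν T₀) U)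
    {f : EuclideanSpace ℝ ι → EuclideanSpace ℝ ι}
    (hreal : ∀ z, U ((((Real.sqrt (ν * τ) : ℝ) : ℂ)), 0) z = complexify (f z))
    {r : ℝ} (hr : r ≤ ν * τ / Real.sqrt (ν * T₀)) :
    ∃ Ut : EuclideanSpace ℂ ι → EuclideanSpace ℂ ι,
      DifferentiableOn ℂ Ut (complexTube ι r) ∧
      (∀ x : EuclideanSpace ℝ ι, Ut (complexify x) = complexify (f x)) ∧
      ∀ z ∈ complexTube ι r, ‖Ut z‖ ≤ K := by
  set m : ℂ := (((Real.sqrt (ν * τ) : ℝ) : ℂ)) with hm_def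
  set R : ℝ := ν * τ / Real.sqrt (ν * T₀) with hR_def
  -- admissible parameters
  have hmemD : ∀ {w : EuclideanSpace ℂ ι}, ‖w‖ < R →
      ((m, -(m ^ 2)⁻¹ • w) : ℂ × EuclideanSpace ℂ ι) ∈ schemeDomain ν T₀ :=
    fun {w} hw => sqrt_neg_inv_smul_mem_schemeDomain hν hτ hτT hw
  -- the extension `x + iy ↦ U(m, -m⁻²(iy))(x)`
  refine ⟨fun ζ => U (m, -(m ^ 2)⁻¹ • (Complex.I • complexify
      (WithLp.toLp 2 fun i => (ζ i).im : EuclideanSpace ℝ ι)))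
    (WithLp.toLp 2 fun i => (ζ i).re : EuclideanSpace ℝ ι), ?_, ?_, ?_⟩
  · -- holomorphy on the tube
    intro ζ₀ hζ₀
    obtain ⟨x₀, y₀, hy₀, rfl⟩ := hζ₀
    -- the local holomorphic model `F ζ = U (m, -m⁻²(ζ - cx x₀)) x₀` on `N = ball (cx x₀) R`
    have hζ₀N : complexify x₀ + Complex.I • complexify y₀ ∈ ball (complexify x₀) R := by
      rw [mem_ball, dist_eq_norm, add_sub_cancel_left, norm_I_smul_complexify]
      exact hy₀.trans_le hr
    have hA : Differentiable ℂ
        (fun ζ : EuclideanSpace ℂ ι => ((m, -(m ^ 2)⁻¹ • (ζ - complexify x₀)) : ℂ × EuclideanSpace ℂ ι)) := by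
      fun_prop
    have hAmaps : MapsTo
        (fun ζ : EuclideanSpace ℂ ι => ((m, -(m ^ 2)⁻¹ • (ζ - complexify x₀)) : ℂ × EuclideanSpace ℂ ι))
        (ball (complexify x₀) R) (schemeDomain ν T₀) := by
      intro ζ hζ
      rw [mem_ball, dist_eq_norm] at hζ
      exact hmemD hζ
    have hF : DifferentiableOn ℂ
        (fun ζ : EuclideanSpace ℂ ι => U (m, -(m ^ 2)⁻¹ • (ζ - complexify x₀)) x₀)
        (ball (complexify x₀) R) :=
      (hU.differentiableOn x₀).comp hA.differentiableOn hAmaps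
    -- the extension agrees with `F` on `N`, by Galilean covariance
    have heq : ∀ ζ ∈ ball (complexify x₀) R,
        U (m, -(m ^ 2)⁻¹ • (Complex.I • complexify
            (WithLp.toLp 2 fun i => (ζ i).im : EuclideanSpace ℝ ι)))
          (WithLp.toLp 2 fun i => (ζ i).re : EuclideanSpace ℝ ι) =
        U (m, -(m ^ 2)⁻¹ • (ζ - complexify x₀)) x₀ := by
      intro ζ hζ
      rw [mem_ball, dist_eq_norm] at hζ
      have hdec := complexify_toLp_re_add_I_smul_toLp_im ζ
      set x : EuclideanSpace ℝ ι := WithLp.toLp 2 fun i => (ζ i).re with hx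
      set y : EuclideanSpace ℝ ι := WithLp.toLp 2 fun i => (ζ i).im with hy
      have hyR : ‖y‖ < R := by
        have h1 : ‖y‖ ≤ ‖ζ - complexify x₀‖ := by
          rw [hy, ← im_toLp_sub_complexify ζ x₀]
          exact norm_im_toLp_le _
        exact h1.trans_lt hζ
      have hq : ((m, -(m ^ 2)⁻¹ • (Complex.I • complexify y)) : ℂ × EuclideanSpace ℂ ι) ∈
          schemeDomain ν T₀ :=
        hmemD (by rwa [norm_I_smul_complexify])
      have hshift : -(m ^ 2)⁻¹ • (Complex.I • complexify y) - (m ^ 2)⁻¹ • complexify (x - x₀) =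
          -(m ^ 2)⁻¹ • (ζ - complexify x₀) := by
        rw [← hdec]
        rw [complexify_add_I_smul_sub_complexify, smul_add, neg_smul, neg_smul]
        abel
      have hq' : ((m, -(m ^ 2)⁻¹ • (Complex.I • complexify y) - (m ^ 2)⁻¹ • complexify (x - x₀)) :
          ℂ × EuclideanSpace ℂ ι) ∈ schemeDomain ν T₀ := by
        rw [hshift]; exact hmemD hζ
      have hc := hcov _ hq x₀ (x - x₀) hq'
      simp only [add_sub_cancel] at hc
      rw [hshift] at hc
      exact hc
    exact ((hF.congr heq).differentiableAt (isOpen_ball.mem_nhds hζ₀N)).differentiableWithinAt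
  · -- real points
    intro x
    have h1 : (WithLp.toLp 2 fun i => ((complexify x : EuclideanSpace ℂ ι) i).im : EuclideanSpace ℝ ι) = 0 := by
      ext i; simp [complexify_apply]
    have h2 : (WithLp.toLp 2 fun i => ((complexify x : EuclideanSpace ℂ ι) i).re : EuclideanSpace ℝ ι) = x := by
      ext i; simp [complexify_apply]
    simp only [h1, h2, map_zero, smul_zero]
    exact hreal x
  · -- the bound on the tube
    intro ζ hζ
    obtain ⟨x, y, hy, rfl⟩ := hζ
    simp only [re_toLp_complexify_add_I_smul, im_toLp_complexify_add_I_smul]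
    have hq : ((m, -(m ^ 2)⁻¹ • (Complex.I • complexify y)) : ℂ × EuclideanSpace ℂ ι) ∈ schemeDomain ν T₀ :=
      hmemD (by rw [norm_I_smul_complexify]; exact hy.trans_le hr)
    exact hU.norm_le _ hq x

end Domain

/-! ### The discharge -/

section Discharge

/-- **Joint measurability of the time translate of a jointly continuous field**: if `uncurry u`
is continuous on `(0, T) × ℝ³` then `(t, x) ↦ u(t - s, x)` is a.e. strongly measurable on
`(s, s + T) × ℝ³`. [folklore] -/
theorem aestronglyMeasurable_uncurry_comp_sub_of_continuousOn
    {u : ℝ → EuclideanSpace ℝ (Fin 3) → EuclideanSpace ℝ (Fin 3)} {T : ℝ} (s : ℝ)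
    (hu : ContinuousOn (uncurry u) (Ioo 0 T ×ˢ univ)) :
    AEStronglyMeasurable (uncurry fun t x => u (t - s) x)
      ((volume : Measure (ℝ × EuclideanSpace ℝ (Fin 3))).restrict (Ioo s (s + T) ×ˢ univ)) := by
  have htr : Continuous fun q : ℝ × EuclideanSpace ℝ (Fin 3) => (q.1 - s, q.2) := by fun_prop
  have hmaps : MapsTo (fun q : ℝ × EuclideanSpace ℝ (Fin 3) => (q.1 - s, q.2)) (Ioo s (s + T) ×ˢ univ)
      (Ioo 0 T ×ˢ univ) := by
    intro q hq
    obtain ⟨hq1, -⟩ := mem_prod.1 hq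
    exact mk_mem_prod ⟨by linarith [hq1.1], by linarith [hq1.2]⟩ (mem_univ _)
  have hv : ContinuousOn (uncurry fun t x => u (t - s) x) (Ioo s (s + T) ×ˢ univ) :=
    hu.comp htr.continuousOn hmaps
  exact hv.aestronglyMeasurable (measurableSet_Ioo.prod MeasurableSet.univ)

/-- **Time translation of Oseen's equation with an a.e. change of the datum**: if `u` solves
`u(τ) = e^{ντΔ}b - B^ν_0(u,u)(τ)` pointwise for `τ ∈ (0, T)` and `b = a` a.e., then
`v(t) = u(t - s)` solves `v(t) = e^{ν(t-s)Δ}a - B^ν_s(v,v)(t)` pointwise (hence a.e.) for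
`t ∈ (s, s + T)` (`oseenDuhamel_translate`, `heatExtension_congr_ae'`). [folklore] -/
theorem translate_ae_eq_heatExtension_sub_oseenDuhamel
    {u : ℝ → EuclideanSpace ℝ (Fin 3) → EuclideanSpace ℝ (Fin 3)} {ν T s : ℝ}
    {a b : EuclideanSpace ℝ (Fin 3) → EuclideanSpace ℝ (Fin 3)} (hba : b =ᵐ[volume] a)
    (hu : ∀ τ ∈ Ioo 0 T, ∀ x, u τ x = heatExtension b (ν * τ) x - oseenDuhamel ν 0 u u τ x)
    {t : ℝ} (ht : t ∈ Ioo s (s + T)) :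
    (fun x => u (t - s) x) =ᵐ[volume] fun x =>
      heatExtension a (ν * (t - s)) x -
        oseenDuhamel ν s (fun τ y => u (τ - s) y) (fun τ y => u (τ - s) y) t x := by
  refine Eventually.of_forall fun x => ?_
  have h := hu (t - s) ⟨by linarith [ht.1], by linarith [ht.2]⟩ x
  have hD : oseenDuhamel ν 0 u u (t - s) x =
      oseenDuhamel ν s (fun τ y => u (τ - s) y) (fun τ y => u (τ - s) y) t x := by
    have h2 := oseenDuhamel_translate ν 0 s (fun τ y => u (τ - s) y) (fun τ y => u (τ - s) y) (t - s) x
    simp only [add_sub_cancel_right, zero_add, sub_add_cancel] at h2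
    exact h2
  rw [UnboundedOperators.heatExtension_congr_ae' hba, hD] at h
  exact h

/-- **The smallness of the doubled window**: with `c₀ = 8√2 C_B K_G + 2K_G + 2`, every
`0 < T₀ ≤ 2ν/(c₀²M²)` satisfies the smallness condition `8 C_B (√(νT₀)/ν) K_G M ≤ 1` of the
Picard iteration (`√(νT₀) ≤ √2 ν/(c₀M)`). [folklore] -/
theorem guberovic2010_smallness {ν M T₀ : ℝ} (hν : 0 < ν) (hM : 0 < M)
    (hT : T₀ ≤ 2 * (ν / ((8 * Real.sqrt 2 * duhamelConstC (Fin 3) * freeConstC (Fin 3) +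
      2 * freeConstC (Fin 3) + 2) ^ 2 * M ^ 2))) :
    8 * (duhamelConstC (Fin 3) * (Real.sqrt (ν * T₀) / ν)) * freeConstC (Fin 3) * M ≤ 1 := by
  set KG : ℝ := freeConstC (Fin 3) with hKG_def
  set CB : ℝ := duhamelConstC (Fin 3) with hCB_def
  have hKG : 0 < KG := freeConstC_pos _
  have hCB : 0 < CB := duhamelConstC_pos _
  have h2 : (0 : ℝ) < Real.sqrt 2 := Real.sqrt_pos.2 two_pos
  set c₀ : ℝ := 8 * Real.sqrt 2 * CB * KG + 2 * KG + 2 with hc₀_def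
  have hc₀0 : 0 < c₀ := by positivity
  have hsq : Real.sqrt (ν * T₀) ≤ Real.sqrt 2 * ν / (c₀ * M) := by
    have h1 : Real.sqrt 2 * ν / (c₀ * M) = Real.sqrt ((Real.sqrt 2 * ν / (c₀ * M)) ^ 2) :=
      (Real.sqrt_sq (by positivity)).symm
    rw [h1]
    refine Real.sqrt_le_sqrt ?_
    have h3 : (Real.sqrt 2 * ν / (c₀ * M)) ^ 2 = ν * (2 * (ν / (c₀ ^ 2 * M ^ 2))) := by
      rw [div_pow, mul_pow, Real.sq_sqrt two_pos.le]
      field_simp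
    rw [h3]
    exact mul_le_mul_of_nonneg_left hT hν.le
  calc 8 * (CB * (Real.sqrt (ν * T₀) / ν)) * KG * M
      = 8 * CB * KG * M / ν * Real.sqrt (ν * T₀) := by ring
    _ ≤ 8 * CB * KG * M / ν * (Real.sqrt 2 * ν / (c₀ * M)) := by gcongr
    _ = 8 * Real.sqrt 2 * CB * KG / c₀ := by field_simp
    _ ≤ 1 := by
        rw [div_le_one hc₀0, hc₀_def]
        linarith

/-- **Guberović 2010 holds** (`guberovic2010_analyticity_radius`): the bounded mild solution from
a weakly divergence-free `a ∈ L^∞(ℝ³)`, `‖a‖_∞ ≤ M`, exists on `(s, s + ν/(c₀²M²))`, solves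
Oseen's equation `v(t) = e^{ν(t-s)Δ}a - B^ν_s(v,v)(t)` there, and every slice `v(t)` extends
holomorphically to the tube `|Im z| < c₀⁻¹√(ν(t-s))` with the bound `c₀M`; here with
`c₀ = 8√2 C_B K_G + 2K_G + 2`. Proof: the complexified Oseen scheme of Lemarié-Rieusset
(`OseenSchemePicard.lean`) from the bounded representative of `a`, time-translated to `s`; the tube
at time `t` is `x + iy ↦ U(√(ντ), -(ντ)⁻¹(iy))(x)`, `τ = t - s`, on the parameter domain
`schemeDomain ν (2τ)` (`exists_tube_extension_of_covariant`, radius `ντ/√(2ντ) = √(ντ)/√2`).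
[cite: Guberovic2010, main theorem (p = ∞ case of Grujić–Kukavica), as restated in BradshawGrujicKukavica2016 Thm. 2.4.1 (PDF p. 31) and Grujic2012 Thm. 3.1 (arXiv:1111.0217 p. 6); proof via LemarieRieusset2016 Thm. 9.12 (pp. 260–263)] -/
theorem guberovic2010_analyticity_radius_holds : guberovic2010_analyticity_radius := by
  -- the constants
  have hKG : 0 < freeConstC (Fin 3) := freeConstC_pos _
  have hCB : 0 < duhamelConstC (Fin 3) := duhamelConstC_pos _
  have h2 : (0 : ℝ) < Real.sqrt 2 := Real.sqrt_pos.2 two_pos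
  have h22 : Real.sqrt 2 ≤ 2 := Real.sqrt_le_iff.2 ⟨by norm_num, by norm_num⟩
  have hpos : 0 ≤ 8 * Real.sqrt 2 * duhamelConstC (Fin 3) * freeConstC (Fin 3) := by positivity
  refine ⟨8 * Real.sqrt 2 * duhamelConstC (Fin 3) * freeConstC (Fin 3) + 2 * freeConstC (Fin 3) + 2,
    by linarith, ?_⟩
  intro ν hν s M hM a ha haM _hdiv
  have hc₀0 : 0 < 8 * Real.sqrt 2 * duhamelConstC (Fin 3) * freeConstC (Fin 3) +
      2 * freeConstC (Fin 3) + 2 := by linarith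
  have hL0 : 0 < ν / ((8 * Real.sqrt 2 * duhamelConstC (Fin 3) * freeConstC (Fin 3) +
      2 * freeConstC (Fin 3) + 2) ^ 2 * M ^ 2) := by positivity
  -- the bounded representative of the datum
  obtain ⟨b, hbm, hbM, hba⟩ : ∃ b : EuclideanSpace ℝ (Fin 3) → EuclideanSpace ℝ (Fin 3),
      AEStronglyMeasurable b volume ∧ (∀ z, ‖b z‖ ≤ M) ∧ b =ᵐ[volume] a := by
    refine ⟨fun z => (M / max M ‖a z‖) • a z, ?_, fun z => ?_, ?_⟩
    · have hc1 : Continuous fun w : EuclideanSpace ℝ (Fin 3) => M / max M ‖w‖ :=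
        continuous_const.div (continuous_const.max continuous_norm)
          fun w => (lt_of_lt_of_le hM (le_max_left _ _)).ne'
      exact (hc1.smul continuous_id).comp_aestronglyMeasurable ha
    · have hmax : 0 < max M ‖a z‖ := lt_of_lt_of_le hM (le_max_left _ _)
      rw [norm_smul, Real.norm_of_nonneg (div_nonneg hM.le hmax.le), div_mul_eq_mul_div,
        div_le_iff₀ hmax]
      exact mul_le_mul_of_nonneg_left (le_max_right _ _) hM.le
    · filter_upwards [ae_norm_le_of_eLpNorm_top_le hM.le haM] with z hz
      rw [max_eq_left hz, div_self hM.ne', one_smul]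
  -- the solution of the complexified scheme from `b`, on the window of `T₀ = L`
  have hsmL := guberovic2010_smallness hν hM (T₀ := ν / ((8 * Real.sqrt 2 *
    duhamelConstC (Fin 3) * freeConstC (Fin 3) + 2 * freeConstC (Fin 3) + 2) ^ 2 * M ^ 2))
    (by linarith)
  refine ⟨fun t x => picardLimitReal ν b (t - s) x,
    aestronglyMeasurable_uncurry_comp_sub_of_continuousOn s
      (continuousOn_uncurry_picardLimitReal hν hbm hM.le hbM hsmL),
    fun t ht => translate_ae_eq_heatExtension_sub_oseenDuhamel hba
      (fun τ hτ x => picardLimitReal_eq hν hbm hM.le hbM hsmL hτ x) ht,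
    fun t ht => ?_⟩
  -- the tube extension at time `t`, with `τ = t - s` and the parameter domain of `T₀ = 2τ`
  have hτ : 0 < t - s := by linarith [ht.1]
  have hτ2 : t - s < 2 * (t - s) := by linarith
  have hsm2 : 8 * (duhamelConstC (Fin 3) * (Real.sqrt (ν * (2 * (t - s))) / ν)) *
      freeConstC (Fin 3) * M ≤ 1 :=
    guberovic2010_smallness hν hM (by linarith [ht.2])
  have hντ : 0 < ν * (t - s) := mul_pos hν hτ
  -- the claimed radius is admissible: `c₀⁻¹√(ντ) ≤ ντ/√(2ντ) = √(ντ)/√2`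
  have hrR : (8 * Real.sqrt 2 * duhamelConstC (Fin 3) * freeConstC (Fin 3) +
      2 * freeConstC (Fin 3) + 2)⁻¹ * Real.sqrt (ν * (t - s)) ≤
      ν * (t - s) / Real.sqrt (ν * (2 * (t - s))) := by
    have hRe : ν * (t - s) / Real.sqrt (ν * (2 * (t - s))) = (Real.sqrt 2)⁻¹ * Real.sqrt (ν * (t - s)) := by
      rw [show ν * (2 * (t - s)) = 2 * (ν * (t - s)) by ring, Real.sqrt_mul two_pos.le,
        div_eq_iff (by positivity)]
      nth_rewrite 1 [← Real.mul_self_sqrt hντ.le]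
      field_simp
    rw [hRe]
    refine mul_le_mul_of_nonneg_right ?_ (Real.sqrt_nonneg _)
    exact (inv_le_inv₀ hc₀0 h2).2 (by linarith)
  obtain ⟨Ut, hUd, hUr, hUb⟩ := exists_tube_extension_of_covariant hν hτ hτ2
    (isSchemeField_picardLimitC hν hbm hM.le hbM hsm2)
    (isGalileanCovariantOn_picardLimitC hν hbm hM.le hbM hsm2)
    (fun z => (complexify_picardLimitReal hν hbm hM.le hbM hsm2 ⟨hτ, hτ2⟩ z).symm) hrR
  refine ⟨Ut, hUd, hUr, fun z hz => (hUb z hz).trans ?_⟩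
  nlinarith

end Discharge

end Literature.Analysis.FluidPDE

end
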